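import Literature.Geometry.Kaehler.NearlyComplexPlanes
import HarnessLib

/-!
# Nearly complex planes contain unitary frames: unitary adapted orthonormal bases

Topic `Literature/Geometry/Kaehler`. Sequel to `NearlyComplexPlanes.lean` (adapted orthonormal bases
`(e₁, …, e_m, f₁, …, f_m)`, `‖f_j - J e_j‖ ≤ 2·5ᵐ·t`, of a real `2m`-plane `V` which is nearly
complex with defect `≤ t` for an orthogonal skew complex structure `J` on a finite-dimensional real
inner product space `F`; complex case `J = i •`). Here the adapted bases are sharpened: **the
frame `(e_j)` can be taken unitary**, `⟪e_i, J e_j⟫ = 0` for all `i, j` — so `(e₁, Je₁, …, e_m, Je_m)`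
is an honest real orthonormal basis of a `J`-complex `m`-plane, within `O(t)` of `V` frame by
frame. The greedy construction of `NearlyComplexPlanes.lean` already has this property: the partner
`f₁ ∝ P_V(Je₁)` of `e₁` makes every vector of `V` orthogonal to `f₁` orthogonal to `Je₁`, so the
recursion in `V ∩ e₁^⊥ ∩ f₁^⊥` stays inside `(Je₁)^⊥`.

* `exists_partner_of_defect_orthogonal` — the partner `f` of a unit vector `e ∈ V`, with the
  transfer `⟪f, v⟫ = 0 → ⟪Je, v⟫ = 0` for `v ∈ V`;
* `exists_unitary_adapted_orthonormal_of_defect` — unitary adapted orthonormal bases (abstract `J`);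
* `exists_unitary_adapted_orthonormal_of_defect_complex` — complex case, with `Orthonormal ℂ e`.

This is the frame on which Wirtinger's equality `ωᵐ/m!(e₁, i e₁, …) = 1`
(`Literature.Geometry.Kaehler.kaehlerPow_complexFrame`) is compared with the volume of `V`
(`NearlyComplexPlanesWirtinger.lean`: Wirtinger with defect, for the mass comparison of nearly
holomorphic cycles, route *HolomorphicityRate* of the Hodge summit). Theorems only.

## References

* D. McDuff, D. Salamon, *Introduction to Symplectic Topology*, 3rd ed. (2017), §2.5. [McDuffSalamon2017]
* R. Harvey, H. B. Lawson, *Calibrated geometries*, Acta Math. 148 (1982), §II.1. [HarveyLawson1982]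
-/

noncomputable section

open scoped InnerProductSpace ComplexConjugate
open Module Submodule

namespace Literature.Geometry.Kaehler

/-! ### Unitary adapted frames (abstract skew isometry) -/

section SkewIsometry

variable {F : Type*} [NormedAddCommGroup F] [InnerProductSpace ℝ F] [FiniteDimensional ℝ F]

/-- **One adapted pair, with orthogonality transfer.** In a nearly complex `V` (defect `≤ t ≤ 1/2`)
every unit vector `e ∈ V` has a partner `f ∈ V` — a unit vector orthogonal to `e` with
`‖f - Je‖ ≤ 2t` — which moreover carries the orthogonality to `Je` inside `V`: every `v ∈ V`
orthogonal to `f` is orthogonal to `Je` (indeed `f = P_V(Je)/‖P_V(Je)‖` and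
`⟪Je, v⟫ = ⟪P_V(Je), v⟫` for `v ∈ V`). Same construction as `exists_partner_of_defect`.
[cite: McDuffSalamon2017, §2.5] -/
theorem exists_partner_of_defect_orthogonal {J : F →ₗᵢ[ℝ] F}
    (hJ : ∀ x y, ⟪J x, y⟫_ℝ = -⟪x, J y⟫_ℝ) {V : Submodule ℝ F} {t : ℝ} (ht : t ≤ 1 / 2)
    (hV : ∀ v ∈ V, ∃ w ∈ V, ‖J v - w‖ ≤ t * ‖v‖) {e : F} (he : e ∈ V) (he1 : ‖e‖ = 1) :
    ∃ f ∈ V, ‖f‖ = 1 ∧ ⟪e, f⟫_ℝ = 0 ∧ ‖f - J e‖ ≤ 2 * t ∧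
      ∀ v ∈ V, ⟪f, v⟫_ℝ = 0 → ⟪J e, v⟫_ℝ = 0 := by
  set u : F := V.starProjection (J e) with hu
  have huV : u ∈ V := starProjection_apply_mem V _
  have hut : ‖J e - u‖ ≤ t := by simpa [he1] using norm_sub_starProjection_le_of_defect J hV he
  have hue : ⟪u, e⟫_ℝ = 0 := inner_starProjection_self_eq_zero_of_skew hJ he
  -- `|‖u‖ - 1| ≤ t`, so `‖u‖ ≥ 1/2 > 0`
  have hnorm : |‖u‖ - 1| ≤ t := by
    have h := abs_norm_sub_norm_le u (J e)
    rw [J.norm_map, he1, norm_sub_rev] at h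
    exact h.trans hut
  have hu_pos : 0 < ‖u‖ := by
    have := (abs_le.1 hnorm).1
    linarith
  refine ⟨‖u‖⁻¹ • u, V.smul_mem _ huV, ?_, ?_, ?_, fun v hv hfv ↦ ?_⟩
  · rw [norm_smul, norm_inv, norm_norm, inv_mul_cancel₀ hu_pos.ne']
  · rw [real_inner_smul_right, real_inner_comm, hue, mul_zero]
  · -- `‖u/‖u‖ - Je‖ ≤ ‖u/‖u‖ - u‖ + ‖u - Je‖ = |1 - ‖u‖| + ‖u - Je‖`
    have h1 : ‖‖u‖⁻¹ • u - u‖ = |1 - ‖u‖| := by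
      have hsmul : ‖u‖⁻¹ • u - u = (‖u‖⁻¹ - 1) • u := by rw [sub_smul, one_smul]
      have habs : |‖u‖⁻¹ - 1| * ‖u‖ = |(‖u‖⁻¹ - 1) * ‖u‖| := by rw [abs_mul, abs_of_pos hu_pos]
      rw [hsmul, norm_smul, Real.norm_eq_abs, habs, sub_mul, inv_mul_cancel₀ hu_pos.ne', one_mul]
    calc ‖‖u‖⁻¹ • u - J e‖ ≤ ‖‖u‖⁻¹ • u - u‖ + ‖u - J e‖ := norm_sub_le_norm_sub_add_norm_sub _ _ _
      _ ≤ t + t := by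
          refine add_le_add ?_ (by rwa [norm_sub_rev] at hut)
          rw [h1, abs_sub_comm]
          exact hnorm
      _ = 2 * t := by ring
  · -- `⟪Je, v⟫ = ⟪P_V(Je), v⟫ = ‖u‖ ⟪f, v⟫ = 0` for `v ∈ V`
    rw [real_inner_smul_left, mul_eq_zero] at hfv
    have huv : ⟪u, v⟫_ℝ = 0 := hfv.resolve_left (inv_ne_zero hu_pos.ne')
    rwa [hu, inner_starProjection_left_eq_right, starProjection_eq_self_iff.2 hv] at huv

/-- **Unitary adapted orthonormal bases of nearly complex planes.** Let `V ⊆ F` be a real subspace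
of dimension `2m`, nearly complex with defect `≤ t` for the skew isometry `J`, `0 ≤ t`,
`2 · 5ᵐ · t ≤ 1`. Then there are `e₁, …, e_m, f₁, …, f_m ∈ V`, orthonormal all together (an
orthonormal basis of `V`), with `‖f_j - J e_j‖ ≤ 2 · 5ᵐ · t`, and such that moreover
**`(e_j)` is a unitary frame: `⟪e_i, J e_j⟫ = 0` for all `i, j`** (so `(e₁, Je₁, …, e_m, Je_m)` is a
real orthonormal basis of the `J`-complex `m`-plane `span {e_j, Je_j}`, within `O(t)` of `V` frame
by frame). The greedy induction of `exists_adapted_orthonormal_of_defect`, run with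
`exists_partner_of_defect_orthogonal`: the later vectors lie in `V ∩ e₁^⊥ ∩ f₁^⊥ ⊆ (Je₁)^⊥`.
[cite: McDuffSalamon2017, §2.5] [cite: HarveyLawson1982, §II.1] -/
theorem exists_unitary_adapted_orthonormal_of_defect {J : F →ₗᵢ[ℝ] F}
    (hJ : ∀ x y, ⟪J x, y⟫_ℝ = -⟪x, J y⟫_ℝ) (m : ℕ) :
    ∀ (V : Submodule ℝ F) (t : ℝ), 0 ≤ t → 2 * 5 ^ m * t ≤ 1 → finrank ℝ V = 2 * m →
      (∀ v ∈ V, ∃ w ∈ V, ‖J v - w‖ ≤ t * ‖v‖) →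
      ∃ e f : Fin m → F, (∀ j, e j ∈ V) ∧ (∀ j, f j ∈ V) ∧ (∀ j, ‖e j‖ = 1) ∧ (∀ j, ‖f j‖ = 1) ∧
        (∀ i j, i ≠ j → ⟪e i, e j⟫_ℝ = 0) ∧ (∀ i j, i ≠ j → ⟪f i, f j⟫_ℝ = 0) ∧
        (∀ i j, ⟪e i, f j⟫_ℝ = 0) ∧ (∀ j, ‖f j - J (e j)‖ ≤ 2 * 5 ^ m * t) ∧
        ∀ i j, ⟪e i, J (e j)⟫_ℝ = 0 := by
  induction m with
  | zero =>
    intro V t _ _ _ _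
    exact ⟨Fin.elim0, Fin.elim0, fun j ↦ j.elim0, fun j ↦ j.elim0, fun j ↦ j.elim0, fun j ↦ j.elim0,
      fun i ↦ i.elim0, fun i ↦ i.elim0, fun i ↦ i.elim0, fun j ↦ j.elim0, fun i ↦ i.elim0⟩
  | succ m ih =>
    intro V t ht hmt hdim hV
    have h5 : (1 : ℝ) ≤ 5 ^ m := one_le_pow₀ (by norm_num)
    have ht2 : t ≤ 1 / 2 := by rw [pow_succ] at hmt; nlinarith
    -- a unit vector `e ∈ V`
    obtain ⟨v, hvV, hv0⟩ : ∃ v ∈ V, v ≠ 0 := by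
      refine V.exists_mem_ne_zero_of_ne_bot fun hbot ↦ ?_
      rw [hbot, finrank_bot] at hdim
      omega
    have hvpos : 0 < ‖v‖ := norm_pos_iff.2 hv0
    set e : F := ‖v‖⁻¹ • v with he_def
    have heV : e ∈ V := V.smul_mem _ hvV
    have he1 : ‖e‖ = 1 := by rw [he_def, norm_smul, norm_inv, norm_norm, inv_mul_cancel₀ hvpos.ne']
    -- its partner `f`, carrying the orthogonality to `Je`
    obtain ⟨f, hfV, hf1, hef, hfe, hfJ⟩ := exists_partner_of_defect_orthogonal hJ ht2 hV heV he1
    -- recurse in `V' = V ∩ e^⊥ ∩ f^⊥`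
    set V' : Submodule ℝ F := (ℝ ∙ f)ᗮ ⊓ ((ℝ ∙ e)ᗮ ⊓ V) with hV'_def
    have hV'le : V' ≤ V := inf_le_right.trans inf_le_right
    have hdim' : finrank ℝ V' = 2 * m :=
      finrank_inf_orthogonal_pair heV hfV he1 hf1 hef (by rw [hdim]; ring)
    have hV' := defect_inf_orthogonal_le hJ hV heV hfV he1 hf1 hef hfe
    obtain ⟨e', f', he'V, hf'V, he'1, hf'1, he'e', hf'f', he'f', hbd, he'J⟩ :=
      ih V' (5 * t) (by positivity) (by rw [pow_succ] at hmt; linarith) hdim' hV'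
    -- orthogonality to `e`, `f` and `Je` of the vectors of `V'`
    have hperp : ∀ x ∈ V', ⟪e, x⟫_ℝ = 0 ∧ ⟪f, x⟫_ℝ = 0 := fun x hx ↦
      ⟨(mem_orthogonal_singleton_iff_inner_right).1 (Submodule.mem_inf.1 (Submodule.mem_inf.1 hx).2).1,
        (mem_orthogonal_singleton_iff_inner_right).1 (Submodule.mem_inf.1 hx).1⟩
    have hperpJ : ∀ x ∈ V', ⟪J e, x⟫_ℝ = 0 := fun x hx ↦ hfJ x (hV'le hx) (hperp x hx).2
    refine ⟨Matrix.vecCons e e', Matrix.vecCons f f', ?_, ?_, ?_, ?_, ?_, ?_, ?_, ?_, ?_⟩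
    · refine Fin.cases (by simpa using heV) (fun j ↦ ?_)
      simpa using hV'le (he'V j)
    · refine Fin.cases (by simpa using hfV) (fun j ↦ ?_)
      simpa using hV'le (hf'V j)
    · exact Fin.cases (by simpa using he1) (fun j ↦ by simpa using he'1 j)
    · exact Fin.cases (by simpa using hf1) (fun j ↦ by simpa using hf'1 j)
    · refine Fin.cases (Fin.cases (fun h ↦ (h rfl).elim) (fun j _ ↦ ?_))
        (fun i ↦ Fin.cases (fun _ ↦ ?_) (fun j hij ↦ ?_))
      · simpa using (hperp _ (he'V j)).1
      · simpa [real_inner_comm] using (hperp _ (he'V i)).1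
      · simpa using he'e' i j fun h ↦ hij (congrArg Fin.succ h)
    · refine Fin.cases (Fin.cases (fun h ↦ (h rfl).elim) (fun j _ ↦ ?_))
        (fun i ↦ Fin.cases (fun _ ↦ ?_) (fun j hij ↦ ?_))
      · simpa using (hperp _ (hf'V j)).2
      · simpa [real_inner_comm] using (hperp _ (hf'V i)).2
      · simpa using hf'f' i j fun h ↦ hij (congrArg Fin.succ h)
    · refine Fin.cases (Fin.cases (by simpa using hef) (fun j ↦ ?_))
        (fun i ↦ Fin.cases ?_ (fun j ↦ ?_))
      · simpa using (hperp _ (hf'V j)).1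
      · simpa [real_inner_comm] using (hperp _ (he'V i)).2
      · simpa using he'f' i j
    · refine Fin.cases ?_ (fun j ↦ ?_)
      · have : 2 * t ≤ 2 * 5 ^ (m + 1) * t := by
          rw [pow_succ]; nlinarith
        simpa using hfe.trans this
      · have h := hbd j
        have : 2 * 5 ^ m * (5 * t) = 2 * 5 ^ (m + 1) * t := by ring
        simpa [this] using h
    · -- unitarity `⟪e_i, J e_j⟫ = 0`
      refine Fin.cases (Fin.cases ?_ (fun j ↦ ?_)) (fun i ↦ Fin.cases ?_ (fun j ↦ ?_))
      · have h : ⟪e, J e⟫_ℝ = 0 := by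
          rw [real_inner_comm]
          exact inner_self_eq_zero_of_skew hJ e
        simpa using h
      · have h : ⟪e, J (e' j)⟫_ℝ = 0 := by
          have h1 := hJ e (e' j)
          rw [hperpJ _ (he'V j)] at h1
          linarith
        simpa using h
      · have h : ⟪e' i, J e⟫_ℝ = 0 := by
          rw [real_inner_comm]
          exact hperpJ _ (he'V i)
        simpa using h
      · simpa using he'J i j

end SkewIsometry

/-! ### The complex case -/

section Complex

variable {E : Type*} [NormedAddCommGroup E] [InnerProductSpace ℂ E] [FiniteDimensional ℂ E]

/-- **Unitary adapted orthonormal bases, complex case.** For a real `2m`-plane `V` of defect `≤ t`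
(`0 ≤ t`, `2 · 5ᵐ · t ≤ 1`) in a finite-dimensional complex inner product space: an orthonormal
basis `(e₁, …, e_m, f₁, …, f_m)` of `V` (real inner product `re ⟪·, ·⟫_ℂ`) with
`‖f_j - i e_j‖ ≤ 2 · 5ᵐ · t` and `(e_j)` **unitary** (`Orthonormal ℂ e`:
`⟪e_i, e_j⟫_ℂ = δ_ij`, its imaginary part being `-re ⟪e_i, i e_j⟫ = 0`).
[cite: McDuffSalamon2017, §2.5] [cite: HarveyLawson1982, §II.1] -/
theorem exists_unitary_adapted_orthonormal_of_defect_complex (m : ℕ) (V : Submodule ℝ E) (t : ℝ)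
    (ht : 0 ≤ t) (hmt : 2 * 5 ^ m * t ≤ 1) (hdim : finrank ℝ V = 2 * m)
    (hV : ∀ v ∈ V, ∃ w ∈ V, ‖Complex.I • v - w‖ ≤ t * ‖v‖) :
    ∃ e f : Fin m → E, (∀ j, e j ∈ V) ∧ (∀ j, f j ∈ V) ∧ (∀ j, ‖e j‖ = 1) ∧ (∀ j, ‖f j‖ = 1) ∧
      (∀ i j, i ≠ j → (⟪e i, e j⟫_ℂ).re = 0) ∧ (∀ i j, i ≠ j → (⟪f i, f j⟫_ℂ).re = 0) ∧
      (∀ i j, (⟪e i, f j⟫_ℂ).re = 0) ∧ (∀ j, ‖f j - Complex.I • e j‖ ≤ 2 * 5 ^ m * t) ∧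
      Orthonormal ℂ e := by
  letI : InnerProductSpace ℝ E := InnerProductSpace.complexToReal
  let J : E →ₗᵢ[ℝ] E :=
    { toLinearMap := (Complex.I • LinearMap.id : E →ₗ[ℂ] E).restrictScalars ℝ
      norm_map' := fun x ↦ by simpa using norm_I_smul_eq x }
  have hJapply : ∀ x, J x = Complex.I • x := fun x ↦ rfl
  have hJ : ∀ x y, ⟪J x, y⟫_ℝ = -⟪x, J y⟫_ℝ := by
    intro x y
    rw [hJapply, hJapply, real_inner_eq_re_inner ℂ, real_inner_eq_re_inner ℂ, inner_smul_left,
      inner_smul_right, Complex.conj_I]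
    simp
  obtain ⟨e, f, heV, hfV, he1, hf1, hee, hff, hef, hbd, heJ⟩ :=
    exists_unitary_adapted_orthonormal_of_defect hJ m V t ht hmt hdim (by simpa only [hJapply] using hV)
  refine ⟨e, f, heV, hfV, he1, hf1, hee, hff, hef, by simpa only [hJapply] using hbd, ?_⟩
  -- `⟪e_i, e_j⟫_ℂ = δ_ij`: real part from orthonormality, imaginary part from unitarity
  have him : ∀ i j, (⟪e i, e j⟫_ℂ).im = 0 := by
    intro i j
    have h := heJ i j
    rw [hJapply, real_inner_eq_re_inner ℂ, inner_smul_right] at h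
    simpa using h
  rw [orthonormal_iff_ite]
  intro i j
  by_cases hij : i = j
  · subst hij
    rw [if_pos rfl]
    apply Complex.ext
    · rw [inner_self_eq_norm_sq_to_K, he1]; norm_num
    · rw [him]; norm_num
  · rw [if_neg hij]
    apply Complex.ext
    · have h := hee i j hij
      rw [real_inner_eq_re_inner ℂ] at h
      simpa using h
    · rw [him]; norm_num


end Complex

end Literature.Geometry.Kaehler

end
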